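import Summits.HodgeConjecture.HodgeCM.PerL34.FockLattice_1

/-! PORT of `HodgeCM/PerL34/FockLattice.lean` (HodgeCMPerL run 82) — part 2: continuation of `Summits.HodgeConjecture.HodgeCM.PerL34.FockLattice_1` (split at a top-level declaration boundary by port_pkg.py; scope re-opened below; declarations unchanged). -/

-- port_pkg: scope re-opened for this part (file-level context, then the namespace/section stack open at the cut)
set_option autoImplicit false
namespace HodgeCM
namespace PerL34
namespace Fock
open MvPolynomial Finsupp
open scoped BigOperators
attribute [local instance 100] LieRing.ofAssociativeRing
section KTypes
/-- an `E₊`-highest vector has no `z₂` in its support -/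
theorem support_inl_one_eq_zero_of_hE01 {f : HarmModel} (h : hE 0 1 f = 0) {m : HarmVar →₀ ℕ}
    (hm : m ∈ f.support) : m (Sum.inl 1) = 0 := by
  by_contra hb
  set n : HarmVar →₀ ℕ := m - single (Sum.inl 1) 1 + single (Sum.inl 0) 1 with hn
  have hn0 : n (Sum.inl 0) ≠ 0 := by
    simp [hn]
  have hnm : n - single (Sum.inl 0) 1 + single (Sum.inl 1) 1 = m := by
    ext v
    rcases v with c | u
    · fin_cases c
      · simp [hn]
      · simp [hn]; omega
    · simp [hn]
  have hc := coeff_hE01 f n hn0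
  rw [h, coeff_zero, hnm] at hc
  have h1 : ((n (Sum.inl 1) + 1 : ℕ) : ℂ) ≠ 0 := Nat.cast_ne_zero.mpr (Nat.succ_ne_zero _)
  exact (MvPolynomial.mem_support_iff.mp hm) ((mul_eq_zero.mp hc.symm).resolve_left h1)

/-- (Ported verbatim from the HodgeCMPerL package; no docstring in the source.) -/
theorem hE01_hmon_zero (a e : ℕ) : hE 0 1 (hmon a 0 e) = 0 := by
  rw [hmon, hE_monomial, hexp_inl_one, Nat.cast_zero, zero_smul]

/-- **`K'`-types with multiplicity one**: inside the layer `F_k^{(e)}` the `E₊ = z₁∂₂`-highest vectors form the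
line `ℂ · z₁^{k+e} w^e` — so each non-zero layer `F_k^{(e)}` (`e ≥ max(0,-k)`) is the irreducible `U(2)`-module of
highest weight `(k+e, 0)` (`≅ Sym^{k+e} ℂ²`, dimension `k+e+1`, cf. `kpiece_le_span`), occurring exactly once. -/
theorem kpiece_highest_iff (k : ℤ) (e : ℕ) {f : HarmModel} (hf : f ∈ kpiece k e) :
    hE 0 1 f = 0 ↔ f ∈ Submodule.span ℂ {hmon (k + e).toNat 0 e} := by
  constructor
  · intro h
    rw [mem_kpiece_iff_support] at hf
    have hsupp : ∀ m ∈ f.support, m = hexp (k + e).toNat 0 e := by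
      intro m hm
      obtain ⟨hk, he⟩ := hf m hm
      have hb := support_inl_one_eq_zero_of_hE01 h hm
      rw [wt_uWt'] at hk
      exact eq_hexp_iff.mpr ⟨by omega, hb, he⟩
    rw [eq_monomial_of_support f _ hsupp, Submodule.mem_span_singleton]
    exact ⟨coeff (hexp (k + e).toNat 0 e) f, by rw [hmon, smul_monomial, smul_eq_mul, mul_one]⟩
  · intro h
    obtain ⟨c, rfl⟩ := Submodule.mem_span_singleton.mp h
    rw [map_smul, hE01_hmon_zero, smul_zero]

/-- the highest vector `z₁^{k+e} w^e` does lie in the layer `F_k^{(e)}` once `k + e ≥ 0` -/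
theorem hmon_highest_mem_kpiece (k : ℤ) (e : ℕ) (h : 0 ≤ k + e) : hmon (k + e).toNat 0 e ∈ kpiece k e := by
  have := hmon_mem_kpiece (k + e).toNat 0 e
  rwa [Nat.cast_zero, add_zero, Int.toNat_of_nonneg h, add_sub_cancel_right] at this

/-- and the layer is non-zero exactly when `k + e ≥ 0` -/
theorem kpiece_ne_bot_iff (k : ℤ) (e : ℕ) : kpiece k e ≠ ⊥ ↔ 0 ≤ k + e := by
  constructor
  · intro h
    by_contra hlt
    exact h (kpiece_eq_bot k e (by omega))
  · intro h hbot
    have := hmon_highest_mem_kpiece k e h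
    rw [hbot, Submodule.mem_bot] at this
    exact hmon_ne_zero _ _ _ this

end KTypes

/-! ## Polarisation kernels; highest weight vectors of `Sym^d ℂ³` -/

section HighestGeneric
variable {σ : Type} [DecidableEq σ]

/-- coefficient extraction for a polarisation `X_a ∂_b` (`a ≠ b`) at an exponent containing `X_a` -/
theorem coeff_X_mul_pderiv_of_ne {a b : σ} (hab : a ≠ b) (f : MvPolynomial σ ℂ) (n : σ →₀ ℕ) (hn : n a ≠ 0) :
    coeff n (X a * pderiv b f) = ((n b + 1 : ℕ) : ℂ) * coeff (n - single a 1 + single b 1) f := by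
  rw [coeff_X_mul', if_pos (Finsupp.mem_support_iff.mpr hn), coeff_pderiv, Finsupp.tsub_apply,
    single_apply, if_neg hab, tsub_zero, mul_comm]
  push_cast
  ring

/-- a polynomial killed by the polarisation `X_a ∂_b` (`a ≠ b`) has no `X_b` in its support -/
theorem support_apply_eq_zero_of_X_mul_pderiv {a b : σ} (hab : a ≠ b) {f : MvPolynomial σ ℂ}
    (h : X a * pderiv b f = 0) {m : σ →₀ ℕ} (hm : m ∈ f.support) : m b = 0 := by
  by_contra hb
  set n : σ →₀ ℕ := m - single b 1 + single a 1 with hn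
  have hba : ¬ b = a := fun h' => hab h'.symm
  have hn0 : n a ≠ 0 := by
    simp only [hn, Finsupp.coe_add, Finsupp.coe_tsub, Pi.add_apply, Pi.sub_apply, single_apply, hba,
      if_false, if_true]
    omega
  have hnm : n - single a 1 + single b 1 = m := by
    ext v
    simp only [hn, Finsupp.coe_add, Finsupp.coe_tsub, Pi.add_apply, Pi.sub_apply, single_apply]
    by_cases hva : a = v
    · subst hva
      simp only [hba, if_true, if_false]
      omega
    · by_cases hvb : b = v
      · subst hvb
        simp only [hva, if_true, if_false]
        omega
      · simp only [hva, hvb, if_false]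
        omega
  have hc := coeff_X_mul_pderiv_of_ne hab f n hn0
  rw [h, coeff_zero, hnm] at hc
  have h1 : ((n b + 1 : ℕ) : ℂ) ≠ 0 := Nat.cast_ne_zero.mpr (Nat.succ_ne_zero _)
  exact (MvPolynomial.mem_support_iff.mp hm) ((mul_eq_zero.mp hc.symm).resolve_left h1)

end HighestGeneric

section DefHighest

/-- **Highest weight vectors of `Sym^d ℂ³`**: inside `Sym^d = dpiece d` the vectors killed by the two simple raising
polarisations `E₁₂ = z₁∂₂`, `E₂₃ = z₂∂₃` form the line `ℂ · z₁^d` — `Sym^d(ℂ³)` is the irreducible `U(3)`-module of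
highest weight `(d,0,0)` with a unique highest line (the `K'`-type statement of Howe duality for `(U(1), U(3))`). -/
theorem dpiece_highest_iff (d : ℕ) {f : DefModel} (hf : f ∈ dpiece d) :
    dE 0 1 f = 0 ∧ dE 1 2 f = 0 ↔ f ∈ Submodule.span ℂ {monomial (single (0 : Fin 3) d) (1 : ℂ)} := by
  constructor
  · rintro ⟨h01, h12⟩
    rw [dE_apply] at h01 h12
    rw [mem_wpiece_iff_support] at hf
    have hsupp : ∀ m ∈ f.support, m = single (0 : Fin 3) d := by
      intro m hm
      have h1 : m 1 = 0 := support_apply_eq_zero_of_X_mul_pderiv (by decide) h01 hm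
      have h2 : m 2 = 0 := support_apply_eq_zero_of_X_mul_pderiv (by decide) h12 hm
      have hd := hf m hm
      rw [wt_one, Nat.cast_inj, degree_eq_sum, Fin.sum_univ_three, h1, h2, add_zero, add_zero] at hd
      ext i
      fin_cases i
      · simpa using hd
      · simpa using h1
      · simpa using h2
    rw [eq_monomial_of_support f _ hsupp, Submodule.mem_span_singleton]
    exact ⟨coeff (single 0 d) f, by rw [smul_monomial, smul_eq_mul, mul_one]⟩
  · intro h
    obtain ⟨c, rfl⟩ := Submodule.mem_span_singleton.mp h
    refine ⟨?_, ?_⟩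
    · rw [map_smul, dE_apply, X_mul_pderiv_monomial', single_apply, if_neg (by decide), Nat.cast_zero, zero_smul,
        smul_zero]
    · rw [map_smul, dE_apply, X_mul_pderiv_monomial', single_apply, if_neg (by decide), Nat.cast_zero, zero_smul,
        smul_zero]

/-- (Ported verbatim from the HodgeCMPerL package; no docstring in the source.) -/
theorem monomial_single_mem_dpiece (d : ℕ) : monomial (single (0 : Fin 3) d) (1 : ℂ) ∈ dpiece d :=
  monomial_mem_wpiece (by rw [wt_one, Nat.cast_inj, degree_eq_sum]; simp) 1

/-- every `Sym^d` is finite-dimensional (spanned by the monomials of degree `d`) -/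
theorem dpiece_finite (d : ℕ) : Module.Finite ℂ ↥(dpiece d) := by
  have hle : dpiece d ≤ Submodule.span ℂ
      ↑((Finset.range (d + 1) ×ˢ Finset.range (d + 1)).image fun ab : ℕ × ℕ =>
        monomial (single (0 : Fin 3) ab.1 + single 1 ab.2 + single 2 (d - ab.1 - ab.2)) (1 : ℂ)) := by
    intro f hf
    rw [mem_wpiece_iff_support] at hf
    rw [f.as_sum]
    refine Submodule.sum_mem _ fun m hm => ?_
    have hd := hf m hm
    rw [wt_one, Nat.cast_inj, degree_eq_sum, Fin.sum_univ_three] at hd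
    have hm' : m = single (0 : Fin 3) (m 0) + single 1 (m 1) + single 2 (d - m 0 - m 1) := by
      ext i
      fin_cases i
      · simp
      · simp
      · simp; omega
    have : monomial m (coeff m f) =
        coeff m f • monomial (single (0 : Fin 3) (m 0) + single 1 (m 1) + single 2 (d - m 0 - m 1)) (1 : ℂ) := by
      rw [smul_monomial, smul_eq_mul, mul_one, ← hm']
    rw [this]
    refine Submodule.smul_mem _ _ (Submodule.subset_span ?_)
    rw [Finset.coe_image]
    refine ⟨(m 0, m 1), ?_, rfl⟩
    simp only [Finset.mem_coe, Finset.mem_product, Finset.mem_range]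
    omega
  exact Submodule.finiteDimensional_of_le hle

end DefHighest

end Fock

end PerL34

end HodgeCM
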